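import Summits.ResolutionOfSingularities.ResolutionOfSingularities.Theorems.WildQuotientsSummitReductionStubPairOrbitBlowupCentreLocalLemmas9
import Summits.ResolutionOfSingularities.ResolutionOfSingularities.Theorems.WildQuotientsSummitReductionStubPairOrbitBlowupCentreLocalLemmas10
import Summits.ResolutionOfSingularities.ResolutionOfSingularities.Theorems.WildQuotientsSummitReductionStubPairOrbitBlowupCentreLocalLemmas12
import Summits.ResolutionOfSingularities.ResolutionOfSingularities.Theorems.WildQuotientsSummitReductionStubPairOrbitBlowupCentreLocalLemmas13
import Summits.ResolutionOfSingularities.ResolutionOfSingularities.Theorems.WildQuotientsSummitReductionStubPairOrbitBlowupCentreLocalLemmas14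
import Literature.AlgebraicGeometry.Resolution.AlterationsSingularComponents
import HarnessLib

/-!
# `WildQuotients.SummitReduction` (stmt-ResolutionOfSingularities-16324), line `FramePerfect`:
# smoothness at a point of the blown-up curve off the chart origins — the algebra
# (stub `stub_pair_orbitBlowupCentreLocal`, file 15)

Route `ResolutionOfSingularities/WildQuotients`, crux `SummitReduction`; helper file of stub
`stub_pair_orbitBlowupCentreLocal` (C2: de Jong 1996, 3.4 Claim (ii) over the orbit centre, with
quasi-splitness upstairs, de Jong 1997, proof of Prop. 5.11 ¶1). Clause (H4) of the stub asserts
the quasi-split datum at the NON-SMOOTH points of `X₁ → Y` over the centre; file 6 gives it at the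
points whose chart prime `𝔔` is the origin (`x̄, ȳ ∈ 𝔔`), so what remains is: **at a point over the
centre whose chart prime does not contain both `x̄` and `ȳ`, `X₁ → Y` is smooth** ("This scheme is
smooth over `k`, except at the maximal ideal `(u, t₁')`", de Jong 1996, p. 64). This file PROVES the
commutative algebra of it (`isSmoothAt_of_chart_of_not_origin`), for `R → S` of finite
presentation, a prime `q` over `p`, `R_p → S_q` flat, and an identification `Ŝ_q ≅ T̂` of
completions with a local ring `T` of a chart `Λ[x, y]/(xy - a₀)` over Cohen coordinates
`R_p → Λ` of the base at a prime `𝔔 ⊇ 𝔪_Λ`, `𝔔 ∌ x̄` or `𝔔 ∌ ȳ`: by the fibre criterion with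
flatness at the point and descent from finite purely inseparable extensions `l₀` of `κ(p)`
(file 13) it suffices that the local rings of `l₀ ⊗_{κ(p)} (κ(p) ⊗_R S)` at the primes over `q` be
regular; these are local rings of `l₀ ⊗_{κ(p)} B`, `B = S_q/𝔪_p S_q`, at primes over `𝔪_B`
(file 14), whose completions are, by the engine (file 9) fed with the level data of `B` (file 12),
completions of local rings of `l₀ ⊗_{κ(p)} (κ(p)[x, y]/(xy - ā))_{𝔔_l}` at primes over `𝔔_l`,
`𝔔_l ∌ x̄` or `∌ ȳ` — regular (file 10); and regularity descends from the completion.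
-/

set_option linter.dupNamespace false

noncomputable section

open IsLocalRing TensorProduct
open Literature.AlgebraicGeometry.Resolution
open Literature.AlgebraicGeometry.Resolution.DeJong1996

namespace Summit.ResolutionOfSingularities.ResolutionOfSingularities.Theorems

universe u

set_option maxHeartbeats 800000 in
/-- **Smoothness at a point from a chart of the completion off the origin** (de Jong 1996, 3.4
Claim (ii), p. 64: "This scheme is smooth over `k`, except at the maximal ideal `(u, t₁')`", for
the blown-up curve through "completion commutes with blowing up"). Let `S` be of finite
presentation over `R` (and Noetherian), `q ⊂ S` a prime over `p ⊂ R` with `R_p → S_q` flat, and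
suppose `Ŝ_q ≅ T̂` compatibly with `R_p → Λ → T` for a residually bijective `β : R_p → Λ` with
`𝔪_p Λ = 𝔪_Λ` (Cohen coordinates of the base) and a local ring `T` of the chart
`Λ[x, y]/(xy - a₀)` at a prime `𝔔 ⊇ 𝔪_Λ` not containing both `x̄` and `ȳ`. Then `S` is
`R`-smooth at `q`. [cite: DeJong1996, 3.4 Claim (ii), p. 64] [cite: DeJong1997, proof of Prop. 5.11, p. 618] -/
theorem isSmoothAt_of_chart_of_not_origin {R S : Type u} [CommRing R] [CommRing S] [Algebra R S]
    [Algebra.FinitePresentation R S] [IsNoetherianRing S]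
    (p : Ideal R) [p.IsPrime] (q' : Ideal (p.Fiber S)) [q'.IsPrime] (q : Ideal S) [q.IsPrime]
    (hq : q = q'.comap (Algebra.TensorProduct.includeRight : S →ₐ[R] p.Fiber S))
    (hpq : p = q.comap (algebraMap R S))
    (hflat : (Localization.localRingHom p q (algebraMap R S) hpq).Flat)
    {Λ : Type u} [CommRing Λ] [IsLocalRing Λ] (β : Localization.AtPrime p →+* Λ)
    (hβM : (maximalIdeal (Localization.AtPrime p)).map β = maximalIdeal Λ)
    (hβR : Function.Surjective ((Ideal.Quotient.mk (maximalIdeal Λ)).comp β))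
    {a₀ : Λ} (𝔔 : Ideal (AlgebraicNodeRing Λ a₀)) [𝔔.IsPrime] (T : Type u) [CommRing T]
    [IsLocalRing T] [IsNoetherianRing T] [Algebra (AlgebraicNodeRing Λ a₀) T]
    [IsLocalization.AtPrime T 𝔔] [Algebra Λ T] [IsScalarTower Λ (AlgebraicNodeRing Λ a₀) T]
    (h𝔔Λ : (maximalIdeal Λ).map (algebraMap Λ (AlgebraicNodeRing Λ a₀)) ≤ 𝔔)
    (E : LocalCpl (Localization.AtPrime q) ≃+* LocalCpl T)
    (hE : ∀ a, E (AdicCompletion.of _ _ (Localization.localRingHom p q (algebraMap R S) hpq a)) =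
      AdicCompletion.of _ _ (algebraMap Λ T (β a)))
    (hoff : ¬ (AlgebraicNodeRing.u Λ a₀ ∈ 𝔔 ∧ AlgebraicNodeRing.v Λ a₀ ∈ 𝔔)) :
    Algebra.IsSmoothAt R q := by
  classical
  subst hq
  -- the fibre criterion with flatness at the point, and descent from finite purely inseparable
  -- extensions of `κ(p)` (file 13)
  refine isSmoothAt_of_flat_of_isSmoothAt_fiber p q' hpq hflat ?_
  refine isSmoothAt_of_forall_isRegularLocalRing_baseChange p.ResidueField (p.Fiber S) q' ?_
  intro l₀ _ _ _ _ x' _ hx'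
  -- notation: `ψ : R_p → S_q`, the fibre local ring `B = S_q/𝔪_p S_q` over `κ(p)`
  let ψ := Localization.localRingHom p (q'.comap (Algebra.TensorProduct.includeRight :
    S →ₐ[R] p.Fiber S)) (algebraMap R S) hpq
  letI algB : Algebra p.ResidueField (Localization.AtPrime (q'.comap
      (Algebra.TensorProduct.includeRight : S →ₐ[R] p.Fiber S)) ⧸
      (maximalIdeal (Localization.AtPrime p)).map ψ) :=
    RingHom.toAlgebra (Ideal.Quotient.lift (maximalIdeal (Localization.AtPrime p))
      ((Ideal.Quotient.mk _).comp ψ)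
      (fun a ha => Ideal.Quotient.eq_zero_iff_mem.mpr (Ideal.mem_map_of_mem ψ ha)))
  have hlB : ∀ a, algebraMap p.ResidueField (Localization.AtPrime (q'.comap
      (Algebra.TensorProduct.includeRight : S →ₐ[R] p.Fiber S)) ⧸
      (maximalIdeal (Localization.AtPrime p)).map ψ) (residue _ a) = Ideal.Quotient.mk _ (ψ a) :=
    fun a => rfl
  -- `B` is local, with maximal ideal `𝔪_{S_q} B`
  have hψloc : IsLocalHom ψ := inferInstance
  have hJB : (maximalIdeal (Localization.AtPrime p)).map ψ ≤ maximalIdeal _ :=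
    ((local_hom_TFAE ψ).out 0 2).mp hψloc
  have hJBne : (maximalIdeal (Localization.AtPrime p)).map ψ ≠ ⊤ :=
    fun h => (maximalIdeal.isMaximal _).ne_top (top_le_iff.mp (h ▸ hJB))
  haveI : Nontrivial (Localization.AtPrime (q'.comap (Algebra.TensorProduct.includeRight :
      S →ₐ[R] p.Fiber S)) ⧸ (maximalIdeal (Localization.AtPrime p)).map ψ) :=
    Ideal.Quotient.nontrivial_iff.mpr hJBne
  haveI hBloc : IsLocalRing (Localization.AtPrime (q'.comap (Algebra.TensorProduct.includeRight :
      S →ₐ[R] p.Fiber S)) ⧸ (maximalIdeal (Localization.AtPrime p)).map ψ) :=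
    IsLocalRing.of_surjective' (Ideal.Quotient.mk _) Ideal.Quotient.mk_surjective
  have h𝔭 : (maximalIdeal (Localization.AtPrime (q'.comap (Algebra.TensorProduct.includeRight :
      S →ₐ[R] p.Fiber S)))).map (Ideal.Quotient.mk ((maximalIdeal (Localization.AtPrime p)).map ψ)) =
      maximalIdeal _ :=
    IsLocalRing.map_maximalIdeal_of_surjective _ Ideal.Quotient.mk_surjective
  -- the level data of `B` (file 12): `g₁ : B → Ĉ`, `C = (κ(p)[x,y]/(xy-ā))_{𝔔_l}`
  obtain ⟨abar, 𝔔l, h𝔔lp, g₁, hu, hv, hg₁l, h₁, hb₁⟩ := exists_levelData_of_chart ψ β hβM hβR 𝔔 h𝔔Λ E hE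
    p.ResidueField IsLocalRing.residue_surjective (fun a => IsLocalRing.residue_eq_zero_iff a) hlB
  haveI := h𝔔lp
  rw [h𝔭] at h₁ hb₁
  obtain ⟨h₂, hb₂⟩ := map_maximalIdeal_and_levelBijective_localCpl (Localization.AtPrime 𝔔l)
  -- `(l₀ ⊗ F)_{x'}` is a local ring of `l₀ ⊗ B` at a prime `𝔑` over `𝔪_B` (file 14)
  obtain ⟨eB⟩ := nonempty_algEquiv_localization_fiber_fibreQuot p q' _ rfl hpq hlB
  obtain ⟨𝔑, h𝔑p, h𝔑B, ⟨ρ⟩⟩ := exists_prime_baseChange_localization_equiv q' eB l₀ x' hx'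
  haveI := h𝔑p
  -- the engine (file 9)
  obtain ⟨𝔑', h𝔑'p, h𝔑'C, -, -, ⟨ε, -⟩⟩ := exists_localCpl_localization_baseChange_equiv l₀ g₁
    (algebraMap _ (LocalCpl (Localization.AtPrime 𝔔l))) (fun c => by rw [hg₁l]; rfl) h₁ h₂ hb₁ hb₂ 𝔑 h𝔑B
  haveI := h𝔑'p
  -- the model (file 10): regular off the origin
  have hoff' : ¬ ((AlgEquiv.refl : AlgebraicNodeRing p.ResidueField abar ≃ₐ[p.ResidueField]
      AlgebraicNodeRing p.ResidueField abar).symm (AlgebraicNodeRing.u p.ResidueField abar) ∈ 𝔔l ∧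
      (AlgEquiv.refl : AlgebraicNodeRing p.ResidueField abar ≃ₐ[p.ResidueField]
      AlgebraicNodeRing p.ResidueField abar).symm (AlgebraicNodeRing.v p.ResidueField abar) ∈ 𝔔l) := by
    rw [AlgEquiv.refl_symm, AlgEquiv.coe_refl, id_eq, id_eq, hu, hv]
    exact hoff
  haveI hreg : IsRegularLocalRing (Localization.AtPrime 𝔑') :=
    (isRegularLocalRing_and_ringKrullDim_localization_baseChange p.ResidueField l₀ abar
      (AlgebraicNodeRing p.ResidueField abar) AlgEquiv.refl 𝔔l (Localization.AtPrime 𝔔l) 𝔑' h𝔑'C).1 hoff'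
  -- regularity passes through the completions and along `ρ`
  haveI : IsRegularLocalRing (LocalCpl (Localization.AtPrime 𝔑')) := isRegularLocalRing_adicCompletion _
  haveI : IsRegularLocalRing (LocalCpl (Localization.AtPrime 𝔑)) :=
    IsRegularLocalRing.of_ringEquiv (R := LocalCpl (Localization.AtPrime 𝔑'))
      (R' := LocalCpl (Localization.AtPrime 𝔑)) ε.symm
  haveI : IsNoetherianRing (l₀ ⊗[p.ResidueField] p.Fiber S) :=
    Algebra.FiniteType.isNoetherianRing l₀ (l₀ ⊗[p.ResidueField] p.Fiber S)
  haveI : IsNoetherianRing (Localization.AtPrime 𝔑) :=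
    isNoetherianRing_of_ringEquiv (Localization.AtPrime x') ρ
  haveI : IsRegularLocalRing (Localization.AtPrime 𝔑) :=
    isRegularLocalRing_of_isRegularLocalRing_adicCompletion inferInstance
  exact IsRegularLocalRing.of_ringEquiv (R := Localization.AtPrime 𝔑) (R' := Localization.AtPrime x') ρ.symm

end Summit.ResolutionOfSingularities.ResolutionOfSingularities.Theorems

end
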